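import Summits.QuantumFields.BalabanUV.T4Continuum.Spine.NE5.SmallnessPrintedKind
import Summits.QuantumFields.BalabanUV.T4Continuum.Spine.NE1p.DressedOutputAnalyticFaces
import Summits.QuantumFields.BalabanUV.T4Continuum.Support.B13Carriers

/-!
# Spine/NE5/EnvelopeOnRecord — row NE5 (node U3), route P1: the W2 wall from H-layer data ON BAŁABAN'S TORUS CATALOGUE and ON THE
# CARRIERS OF RECORD, every geometry binder discharged (companion of `Spine/NE5/EnvelopeFromActivities`)

Cell `pub-balaban-gaps` (YM blitz Y1, track G2), seat `ne5` (`prover-pub-balaban-gaps-ne5-g2-0`), triage sheet `HOME/ne/NE5.md` §6 T3 ∕ §9 (n1).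
Imports `Spine/NE5/SmallnessPrintedKind` (gen 0 of this seat: the typer's leaf index with faces E1 ∕ E1′ BY NAME + the ε₁-threshold lemmas; the
companion `Spine/NE5/EnvelopeFromActivities` p340702 proves the same envelope over ABSTRACT scale-indexed polymer systems and is not needed here),
`Spine/NE1p/DressedOutputAnalyticFaces` (row NE1′ crew: the (1.18)-type pair «holomorphic + (2.41)-bounded» over a `B13Resummation.Geometry`
bundle with the decidability instances as BINDERS, and the located numerals of the torus bundle `tgeometry 4 N`: ν = 9, c₁ = 64,
K₀ = `B12TreeDecay.K₀ 64 8`, κ₀ = 64 log 162, c = 5 — `torus_consts`, `K₀_four`) and `Support/B13Carriers` (row NE5's paired-torus CARRIERS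
OF RECORD `B13Carriers.TwoRuns.carriers`: `Dom = Σ j, TDom 4 (R.cubesPerDir j)`, `scale = j`, `d ⟨j, X⟩ = torusTreeLen X.1`); modifies nothing;
THEOREMS ONLY.

WHAT THIS FILE DOES (compositions BY NAME; no estimate of its own).
* §1 `outputEnvelope_of_activities_torus` ∕ `ne5_of_leaves_fibre_activities_torus` — the envelope theorem when the scale-k polymer system IS
  the localization-domain catalogue `TreeLengthTorus.tsys 4 (N k)` of the four-torus of `(N k)⁴` unit cubes (touching `TTouch`, tree length
  `torusTreeLen`) and the carriers' `d` is dominated by the footprint's tree length: EVERY geometry binder of the abstract envelope theorem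
  `EnvelopeFromActivities.outputEnvelope_of_activities` (footprint-locality, reach, (1.26), volume, (2.27), non-emptiness) is discharged by
  the tree; hypotheses left = «(2.13) as the definition of the output on the catalogue» (`hrep`), «`d ≤ torusTreeLen` of the footprint»
  (`hdX`), the H-layer datum (`hH`), and the two one-run clauses with located numerals `κ + 128·log 162 + 2 ≤ R`,
  `A·e^{5κ+1}·K₀(64,8)·576 ≤ 1`; `G = e·9·64·K₀(64,8)²·A`.
* §2 `outputEnvelope_of_activities_record` ∕ `ne5_of_leaves_fibre_activities_record` — the same ON THE CARRIERS OF RECORD `R.carriers`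
  (`R : B13Carriers.TwoRuns G`): the footprint map and the tree-length hypothesis disappear too (`d = torusTreeLen` by definition);
  hypotheses left = «`M.Out j z ⟨j, X⟩ = locE TTouch (·.1) (act j z) X.1`» + `hH` + the two clauses; conclusion literally
  `T4OutputRate.NE5 EA EB W κ θ′ C₅` over `R.carriers` from the leaves with W2 := H-layer datum.  THIS IS THE NE5-SIDE W2 TARGET FOR THE
  ONE NEUTRAL STEP OBJECT, stated on the row's own carriers: hand over the scale-j activities `act j : Op × Hist → TDom 4 (R.cubesPerDir j) → ℂ`
  with (2.13) as the definition of the output and [II] Lemma 3 (2.38) + per-polymer holomorphy on the (1.5) ∕ (2.16)–(2.18) class near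
  every admissible box — the same layer and kind of datum as row D4's builder list (D4-CRUX-SOCKETS §9 (K3)).
* §3 `eps_threshold_record` ∕ `ne5_of_leaves_fibre_activities_record_eps` — §2 with the (2.38) constant written `A = C₃·ε₁` ([II] Lemma 3,
  TYPE): both W2 clauses are ε₁-thresholds, with ONE explicit `ε⋆ = min(1/(C₃·e^{5κ+1}·K₀(64,8)·576 + 1), (θ′−ω)(1−ρ₀)/(e·576·K₀(64,8)²·C₃·c_H + 1))`
  in the located numerals (companion of `SmallnessPrintedKind` ∕ `EnvelopeFromActivities` §4).
TECHNICAL NOTE (for other consumers of the NE1′ faces).  `DressedOutputAnalyticFaces.…_torus` fixes CLASSICAL decidability instances for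
`(tsys 4 N).Dom` ∕ `TTouch`; once `Support/B13Carriers` is imported, `B13Carriers.TwoRuns.instDecidableEqTDom` is found for `TDom 4 N` instead
and the two `locE` terms no longer unify.  Hence the theorems below take the decidability instances as BINDERS and feed the instance-generic
face `…_of_geometry (tgeometry 4 N)` with them (`letI … := inferInstanceAs …`).

HONEST FRAMING.  NE5 (`T4OutputRate.NE5`) is a cell NEW ESTIMATE — NOT PRINTED (GAPS G-t4-U3-1) and NOT PROVED; [folklore] bookkeeping by
name; the activities `act` and their (2.38)-majorant are HYPOTHESES (the object ∕ Lemma-3 content of the shared crux), so 0/12 leaves on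
Bałaban's objects are instantiated here; the identification of `tsys 4 N` ∕ `torusTreeLen` with Bałaban's 𝐃_{k+1} ∕ d_{k+1} is pv22's READING
(as in the NE1′ faces), asserted nowhere.  Rung (B)+1 bookkeeping on a FIXED finite T⁴ — NOT the continuum limit by itself, NOT infinite
volume, NOT a mass gap, NOT Clay.  Spine PROVED 0/9.  HONEST DEPENDENCY: continuum YM on T⁴ ⇐ BetaPertH ∧ nine spine estimates (0/9 proved);
BetaPertH ⇐ (D1) ∧ (D4) ∧ CAP+tail.  0 sorry; axioms standard.
-/

noncomputable section

open Set Metric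

namespace Summit.QuantumFields.BalabanUV.T4Continuum.Spine.NE5

open Literature.MathematicalPhysics.QuantumFieldTheory.Balaban1983to89
open Literature.MathematicalPhysics.QuantumFieldTheory.Balaban1983to89.T4OutputRate
open Literature.MathematicalPhysics.QuantumFieldTheory.Balaban1983to89.T4InputCauchyRateData
open Literature.MathematicalPhysics.QuantumFieldTheory.Balaban1983to89.B13Resummation (locE)
open Literature.MathematicalPhysics.QuantumFieldTheory.Balaban1983to89.TreeLengthTorus (TPt TDom tsys torusTreeLen)
open Literature.MathematicalPhysics.QuantumFieldTheory.Balaban1983to89.TreeLengthTorusGeometry (TTouch tgeometry)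
open Literature.MathematicalPhysics.QuantumFieldTheory.Balaban1983to89.B12TreeDecay (K₀)
open Summit.QuantumFields.BalabanUV.T4Continuum.NE1p.DressedOutputAnalyticFaces (analytic_and_bounded_locE_param_of_geometry)
open Summit.QuantumFields.BalabanUV.T4Continuum.NE1p.DressedSmallFieldGeometry (torus_consts)
open Summit.QuantumFields.BalabanUV.T4Continuum.NE1p.DressedSmallFieldGeometryFaces (K₀_four)
open Summit.QuantumFields.BalabanUV.T4Continuum.B13Carriers (TwoRuns)

/-! ## §1 On Bałaban's periodic carrier `tsys 4 N`: every geometry binder discharged, constants located as numerals -/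

section Torus

variable {C : Carriers} {Op Hist : Type*} [NormedAddCommGroup Op] [NormedSpace ℂ Op] [NormedAddCommGroup Hist]
  [NormedSpace ℂ Hist] (M : StepModel C Op Hist)
variable {Nk : ℕ → ℕ} [∀ k, NeZero (Nk k)]
-- decidability instances as BINDERS (any consumer's instances unify; cf. `NE1p.DressedOutputAnalyticFaces` §1)
variable [∀ k, DecidableEq (TDom 4 (Nk k))] [∀ k, DecidableRel (TTouch (d := 4) (N := Nk k))]

/-- **THE OUTPUT ENVELOPE FROM H-LAYER DATA ON THE FOUR-TORUS CATALOGUE — NO GEOMETRY HYPOTHESIS.**  Scale by scale the polymer system is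
Bałaban's localization-domain catalogue `tsys 4 (Nk k)` (the torus of `(Nk k)⁴` unit cubes at scale `k`; footprints `Z.1`, tree length
`torusTreeLen`, touching `TTouch`); the output at a scale-`k` carrier domain `X` is (2.13) at its footprint `fp k X` (`hrep`) and the carriers'
`d X` is at most the footprint's tree length (`hdX`).  Then the H-layer datum (`hH`: around every admissible box an open neighbourhood on which
every activity is ℂ-differentiable in the data and dominated by `A·e^{−R·d(Z)}`) and the two one-run clauses with LOCATED numerals
(`κ + 128·log 162 + 2 ≤ R`, `A·e^{5κ+1}·K₀(64,8)·9·64 ≤ 1`) give `OutputEnvelope W κ (e·9·64·K₀(64,8)²·A)`.  Proof =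
`NE1p.DressedOutputAnalyticFaces.analytic_and_bounded_locE_param_of_geometry` at the bundle `tgeometry 4 (Nk k)` and parameter space
`Op × Hist`, constants rewritten by `torus_consts` ∕ `K₀_four` (the pattern of its `…_torus` face, with the decidability instances left
generic so that they unify with the consumer's). [folklore] -/
theorem outputEnvelope_of_activities_torus
    {fp : (k : ℕ) → C.Dom → (tsys 4 (Nk k)).Dom} {act : (k : ℕ) → Op × Hist → (tsys 4 (Nk k)).Dom → ℂ}
    {W : Set (ℕ → ℝ)} {A R κ : ℝ}
    (hrep : ∀ (k : ℕ) (X : C.Dom) (z : Op × Hist), C.scale X = k →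
      M.Out k z.1 z.2 X =
        locE (TTouch (d := 4) (N := Nk k)) (fun Z : (tsys 4 (Nk k)).Dom => Z.1) (act k z) (fp k X).1)
    (hdX : ∀ (k : ℕ) (X : C.Dom), C.scale X = k → C.d X ≤ torusTreeLen (fp k X).1)
    (hA : 0 ≤ A) (hκ : 0 ≤ κ) (hrate : κ + 2 * (64 * Real.log 162) + 2 ≤ R)
    (hsmall : A * Real.exp (5 * κ + 1) * K₀ 64 8 * 9 * 64 ≤ 1)
    (hH : ∀ k, ∀ g ∈ W, ∀ (U : C.BgB) (p : Op × Hist), p ∈ M.Base k g U →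
      ∃ V : Set (Op × Hist), IsOpen V ∧ M.box k p ⊆ V ∧
        (∀ Z : (tsys 4 (Nk k)).Dom, DifferentiableOn ℂ (fun z : Op × Hist => act k z Z) V) ∧
        (∀ z ∈ V, ∀ Z : (tsys 4 (Nk k)).Dom, ‖act k z Z‖ ≤ A * Real.exp (-(R * torusTreeLen Z.1)))) :
    M.OutputEnvelope W κ (Real.exp 1 * 9 * 64 * K₀ 64 8 ^ 2 * A) := by
  intro k g hg U p hp X hX
  obtain ⟨V, hV, hbox, hhol, hmaj⟩ := hH k g hg U p hp
  obtain ⟨hν, hκ₀, hc₁⟩ := torus_consts (Nk k)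
  have hK := K₀_four (N := Nk k)
  -- the geometry face reads its decidability instances at `(tsys 4 N).Dom` ∕ `(tgeometry 4 N).ι`: hand it OUR binder instances
  letI : DecidableEq (tsys 4 (Nk k)).Dom := inferInstanceAs (DecidableEq (TDom 4 (Nk k)))
  letI : DecidableRel (tgeometry 4 (Nk k)).ι := inferInstanceAs (DecidableRel (TTouch (d := 4) (N := Nk k)))
  -- the (1.18)-type pair over the torus geometry bundle `tgeometry 4 (Nk k)`
  obtain ⟨hdiff, hbd⟩ :=
    analytic_and_bounded_locE_param_of_geometry (tgeometry 4 (Nk k)) (P := Op × Hist)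
      (m := fun Z : (tsys 4 (Nk k)).Dom => A * Real.exp (-(R * torusTreeLen Z.1))) (act := act k) (R := R) (fp k X) hV hA hκ
      (by rw [hκ₀]; exact hrate) (by rw [hK, hν, hc₁]; exact hsmall) (fun Z _ => hhol Z) (fun z hz Z _ => hmaj z hz Z)
      (fun Z _ => le_rfl)
  rw [hν, hc₁, hK] at hbd
  refine ⟨(hdiff.mono hbox).congr fun z _ => hrep k X z hX, fun z hz => ?_⟩
  have hbd' : ‖locE (TTouch (d := 4) (N := Nk k)) (fun Z : (tsys 4 (Nk k)).Dom => Z.1) (act k z) (fp k X).1‖ ≤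
      Real.exp 1 * 9 * 64 * K₀ 64 8 ^ 2 * A * Real.exp (-(κ * torusTreeLen (fp k X).1)) := hbd z (hbox hz)
  rw [hrep k X z hX]
  refine hbd'.trans ?_
  have hG : 0 ≤ Real.exp 1 * 9 * 64 * K₀ 64 8 ^ 2 * A := by positivity
  refine mul_le_mul_of_nonneg_left (Real.exp_le_exp.2 ?_) hG
  have := mul_le_mul_of_nonneg_left (hdX k X hX) hκ
  linarith

/-- **E1′ ON THE TORUS CATALOGUE WITH W2 := H-LAYER DATA** — `LeafIndex.ne5_of_leaves_fibre` BY NAME, its W2 leaves manufactured from §1's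
envelope (`G = e·9·64·K₀(64,8)²·A`); every other leaf displayed. [folklore] -/
theorem ne5_of_leaves_fibre_activities_torus
    {fp : (k : ℕ) → C.Dom → (tsys 4 (Nk k)).Dom} {act : (k : ℕ) → Op × Hist → (tsys 4 (Nk k)).Dom → ℂ}
    {W : Set (ℕ → ℝ)} {A R κ : ℝ}
    (hrep : ∀ (k : ℕ) (X : C.Dom) (z : Op × Hist), C.scale X = k →
      M.Out k z.1 z.2 X =
        locE (TTouch (d := 4) (N := Nk k)) (fun Z : (tsys 4 (Nk k)).Dom => Z.1) (act k z) (fp k X).1)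
    (hdX : ∀ (k : ℕ) (X : C.Dom), C.scale X = k → C.d X ≤ torusTreeLen (fp k X).1)
    (hA : 0 ≤ A) (hκ : 0 ≤ κ) (hrate : κ + 2 * (64 * Real.log 162) + 2 ≤ R)
    (hsmall : A * Real.exp (5 * κ + 1) * K₀ 64 8 * 9 * 64 ≤ 1)
    (hH : ∀ k, ∀ g ∈ W, ∀ (U : C.BgB) (p : Op × Hist), p ∈ M.Base k g U →
      ∃ V : Set (Op × Hist), IsOpen V ∧ M.box k p ⊆ V ∧
        (∀ Z : (tsys 4 (Nk k)).Dom, DifferentiableOn ℂ (fun z : Op × Hist => act k z Z) V) ∧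
        (∀ z ∈ V, ∀ Z : (tsys 4 (Nk k)).Dom, ‖act k z Z‖ ≤ A * Real.exp (-(R * torusTreeLen Z.1))))
    {EA : Functional C C.BgA} {EB : Functional C C.BgB} {EA₀ E₀ E₁ δ δ' θ θ' cH ω ρ₀ B : ℝ} {k₀ : ℕ}
    (l01 : L01 M EA W) (l02 : L02 M EB W) (l03 : L03 M EB W) (l05 : L05 EA W EA₀ κ) (l06 : L06 EB W E₀ κ)
    (l07 : L07 M W δ θ) (l08 : L08 M W κ E₀ δ' θ) (l09aff : L09aff M W) (l09blind : L09blind M W) (l09hom : L09hom M W)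
    (l09unit : L09unit M W κ E₁ cH ω) (hE₁ : 0 < E₁) (hδ : 0 ≤ δ + δ') (hθ : 0 ≤ θ) (hθθ' : θ ≤ θ') (hθ'1 : θ' ≤ 1)
    (hcH : 0 ≤ cH) (hω : 0 < ω) (hρ₀ : ρ₀ < 1) (l10near : (δ + δ') * θ ^ k₀ + cH * (EA₀ + E₀) / (1 - ω) ≤ ρ₀) (hB : 0 ≤ B)
    (l10first : ∀ k < k₀, EA₀ + E₀ ≤ B * θ ^ k)
    (l11 : ω + Real.exp 1 * 9 * 64 * K₀ 64 8 ^ 2 * A / (1 - ρ₀) * cH < θ') :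
    NE5 EA EB W κ θ'
      ((Real.exp 1 * 9 * 64 * K₀ 64 8 ^ 2 * A / (1 - ρ₀) * (δ + δ') + B) * (θ' - ω) /
        (θ' - (ω + Real.exp 1 * 9 * 64 * K₀ 64 8 ^ 2 * A / (1 - ρ₀) * cH))) :=
  have henv := outputEnvelope_of_activities_torus M hrep hdX hA hκ hrate hsmall hH
  ne5_of_leaves_fibre M l01 l02 l03 (M.opFibreEnvelope_of_outputEnvelope henv) (M.histFibreEnvelope_of_outputEnvelope henv)
    l05 l06 l07 l08 l09aff l09blind l09hom l09unit hE₁ (by positivity) hδ hθ hθθ' hθ'1 hcH hω hρ₀ l10near hB l10first l11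

end Torus

/-! ## §2 On the CARRIERS OF RECORD `B13Carriers.TwoRuns.carriers`: no footprint map, no tree-length hypothesis -/

section Record

variable {G : Type} [GaugeGroup G] (R : TwoRuns G)
variable {Op Hist : Type*} [NormedAddCommGroup Op] [NormedSpace ℂ Op] [NormedAddCommGroup Hist] [NormedSpace ℂ Hist]
  (M : StepModel R.carriers Op Hist)
variable [∀ j, DecidableEq (TDom 4 (R.cubesPerDir j))] [∀ j, DecidableRel (TTouch (d := 4) (N := R.cubesPerDir j))]

/-- **THE OUTPUT ENVELOPE FROM H-LAYER DATA ON THE CARRIERS OF RECORD.**  For a step model over row NE5's paired-torus carriers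
`R.carriers` (domains `⟨j, X⟩` with `X` a localization domain of the scale-`j` catalogue `tsys 4 (R.cubesPerDir j)`, `scale = j`,
`d = torusTreeLen X.1` by definition) whose output at `⟨j, X⟩` IS (2.13) of scale-`j` activities depending on the data (`hrep`), the H-layer
datum `hH` and the two one-run clauses with located numerals give `OutputEnvelope W κ (e·9·64·K₀(64,8)²·A)` — every geometry binder, the
footprint map and the tree-length comparison of §1 discharged BY DEFINITION of the carriers. [folklore] -/
theorem outputEnvelope_of_activities_record
    {act : (j : ℕ) → Op × Hist → TDom 4 (R.cubesPerDir j) → ℂ} {W : Set (ℕ → ℝ)} {A Rd κ : ℝ}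
    (hrep : ∀ (X : R.carriers.Dom) (z : Op × Hist),
      M.Out X.1 z.1 z.2 X =
        locE (TTouch (d := 4) (N := R.cubesPerDir X.1)) (fun Z : (tsys 4 (R.cubesPerDir X.1)).Dom => Z.1) (act X.1 z) X.2.1)
    (hA : 0 ≤ A) (hκ : 0 ≤ κ) (hrate : κ + 2 * (64 * Real.log 162) + 2 ≤ Rd)
    (hsmall : A * Real.exp (5 * κ + 1) * K₀ 64 8 * 9 * 64 ≤ 1)
    (hH : ∀ j, ∀ g ∈ W, ∀ (U : R.carriers.BgB) (p : Op × Hist), p ∈ M.Base j g U →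
      ∃ V : Set (Op × Hist), IsOpen V ∧ M.box j p ⊆ V ∧
        (∀ Z : TDom 4 (R.cubesPerDir j), DifferentiableOn ℂ (fun z : Op × Hist => act j z Z) V) ∧
        (∀ z ∈ V, ∀ Z : TDom 4 (R.cubesPerDir j), ‖act j z Z‖ ≤ A * Real.exp (-(Rd * torusTreeLen Z.1)))) :
    M.OutputEnvelope W κ (Real.exp 1 * 9 * 64 * K₀ 64 8 ^ 2 * A) := by
  intro k g hg U p hp X hX
  obtain ⟨j, Y⟩ := X
  change j = k at hX
  subst hX
  obtain ⟨V, hV, hbox, hhol, hmaj⟩ := hH j g hg U p hp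
  obtain ⟨hν, hκ₀, hc₁⟩ := torus_consts (R.cubesPerDir j)
  have hK := K₀_four (N := R.cubesPerDir j)
  letI : DecidableEq (tsys 4 (R.cubesPerDir j)).Dom := inferInstanceAs (DecidableEq (TDom 4 (R.cubesPerDir j)))
  letI : DecidableRel (tgeometry 4 (R.cubesPerDir j)).ι :=
    inferInstanceAs (DecidableRel (TTouch (d := 4) (N := R.cubesPerDir j)))
  obtain ⟨hdiff, hbd⟩ :=
    analytic_and_bounded_locE_param_of_geometry (tgeometry 4 (R.cubesPerDir j)) (P := Op × Hist)
      (m := fun Z : (tsys 4 (R.cubesPerDir j)).Dom => A * Real.exp (-(Rd * torusTreeLen Z.1))) (act := act j) (R := Rd) Y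
      hV hA hκ (by rw [hκ₀]; exact hrate) (by rw [hK, hν, hc₁]; exact hsmall) (fun Z _ => hhol Z)
      (fun z hz Z _ => hmaj z hz Z) (fun Z _ => le_rfl)
  rw [hν, hc₁, hK] at hbd
  refine ⟨(hdiff.mono hbox).congr fun z _ => hrep ⟨j, Y⟩ z, fun z hz => ?_⟩
  have hbd' : ‖locE (TTouch (d := 4) (N := R.cubesPerDir j)) (fun Z : (tsys 4 (R.cubesPerDir j)).Dom => Z.1) (act j z) Y.1‖ ≤
      Real.exp 1 * 9 * 64 * K₀ 64 8 ^ 2 * A * Real.exp (-(κ * torusTreeLen Y.1)) := hbd z (hbox hz)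
  rw [hrep ⟨j, Y⟩ z]
  exact hbd'

/-- **E1′ ON THE CARRIERS OF RECORD WITH W2 := H-LAYER DATA** — `LeafIndex.ne5_of_leaves_fibre` BY NAME over `R.carriers`, its W2 leaves
manufactured from §2's envelope; conclusion literally `T4OutputRate.NE5 EA EB W κ θ′ C₅` on the carriers of record. [folklore] -/
theorem ne5_of_leaves_fibre_activities_record
    {act : (j : ℕ) → Op × Hist → TDom 4 (R.cubesPerDir j) → ℂ} {W : Set (ℕ → ℝ)} {A Rd κ : ℝ}
    (hrep : ∀ (X : R.carriers.Dom) (z : Op × Hist),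
      M.Out X.1 z.1 z.2 X =
        locE (TTouch (d := 4) (N := R.cubesPerDir X.1)) (fun Z : (tsys 4 (R.cubesPerDir X.1)).Dom => Z.1) (act X.1 z) X.2.1)
    (hA : 0 ≤ A) (hκ : 0 ≤ κ) (hrate : κ + 2 * (64 * Real.log 162) + 2 ≤ Rd)
    (hsmall : A * Real.exp (5 * κ + 1) * K₀ 64 8 * 9 * 64 ≤ 1)
    (hH : ∀ j, ∀ g ∈ W, ∀ (U : R.carriers.BgB) (p : Op × Hist), p ∈ M.Base j g U →
      ∃ V : Set (Op × Hist), IsOpen V ∧ M.box j p ⊆ V ∧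
        (∀ Z : TDom 4 (R.cubesPerDir j), DifferentiableOn ℂ (fun z : Op × Hist => act j z Z) V) ∧
        (∀ z ∈ V, ∀ Z : TDom 4 (R.cubesPerDir j), ‖act j z Z‖ ≤ A * Real.exp (-(Rd * torusTreeLen Z.1))))
    {EA : Functional R.carriers R.carriers.BgA} {EB : Functional R.carriers R.carriers.BgB}
    {EA₀ E₀ E₁ δ δ' θ θ' cH ω ρ₀ B : ℝ} {k₀ : ℕ}
    (l01 : L01 M EA W) (l02 : L02 M EB W) (l03 : L03 M EB W) (l05 : L05 EA W EA₀ κ) (l06 : L06 EB W E₀ κ)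
    (l07 : L07 M W δ θ) (l08 : L08 M W κ E₀ δ' θ) (l09aff : L09aff M W) (l09blind : L09blind M W) (l09hom : L09hom M W)
    (l09unit : L09unit M W κ E₁ cH ω) (hE₁ : 0 < E₁) (hδ : 0 ≤ δ + δ') (hθ : 0 ≤ θ) (hθθ' : θ ≤ θ') (hθ'1 : θ' ≤ 1)
    (hcH : 0 ≤ cH) (hω : 0 < ω) (hρ₀ : ρ₀ < 1) (l10near : (δ + δ') * θ ^ k₀ + cH * (EA₀ + E₀) / (1 - ω) ≤ ρ₀) (hB : 0 ≤ B)
    (l10first : ∀ k < k₀, EA₀ + E₀ ≤ B * θ ^ k)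
    (l11 : ω + Real.exp 1 * 9 * 64 * K₀ 64 8 ^ 2 * A / (1 - ρ₀) * cH < θ') :
    NE5 EA EB W κ θ'
      ((Real.exp 1 * 9 * 64 * K₀ 64 8 ^ 2 * A / (1 - ρ₀) * (δ + δ') + B) * (θ' - ω) /
        (θ' - (ω + Real.exp 1 * 9 * 64 * K₀ 64 8 ^ 2 * A / (1 - ρ₀) * cH))) :=
  have henv := outputEnvelope_of_activities_record R M hrep hA hκ hrate hsmall hH
  ne5_of_leaves_fibre M l01 l02 l03 (M.opFibreEnvelope_of_outputEnvelope henv) (M.histFibreEnvelope_of_outputEnvelope henv)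
    l05 l06 l07 l08 l09aff l09blind l09hom l09unit hE₁ (by positivity) hδ hθ hθθ' hθ'1 hcH hω hρ₀ l10near hB l10first l11

end Record

/-! ## §3 On the carriers of record with the (2.38) constant written `A = C₃·ε₁`: both W2 clauses as ε₁-thresholds in located numerals -/

section RecordEps

variable {G : Type} [GaugeGroup G] (R : TwoRuns G)
variable {Op Hist : Type*} [NormedAddCommGroup Op] [NormedSpace ℂ Op] [NormedAddCommGroup Hist] [NormedSpace ℂ Hist]
  (M : StepModel R.carriers Op Hist)
variable [∀ j, DecidableEq (TDom 4 (R.cubesPerDir j))] [∀ j, DecidableRel (TTouch (d := 4) (N := R.cubesPerDir j))]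

/-- **ONE ε₁-THRESHOLD FOR BOTH W2 CLAUSES ON THE RECORD, IN LOCATED NUMERALS** (letters only): for `0 ≤ C₃`, `0 ≤ cH`, `ω < θ′`, `ρ₀ < 1`
there is `ε⋆ > 0` — explicitly `min(1/(C₃·e^{5κ+1}·K₀(64,8)·576 + 1), (θ′−ω)(1−ρ₀)/(e·576·K₀(64,8)²·C₃·cH + 1))` — below which the [KP86]
clause `C₃ε₁·e^{5κ+1}·K₀(64,8)·9·64 ≤ 1` AND the route's sharp clause `(e·9·64·K₀(64,8)²·C₃)·cH·ε₁ < (θ′−ω)(1−ρ₀)` hold.  [folklore] -/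
theorem eps_threshold_record {C3 κ cH θ' ω ρ₀ : ℝ} (hC3 : 0 ≤ C3) (hcH : 0 ≤ cH) (hωθ' : ω < θ') (hρ₀ : ρ₀ < 1) :
    ∃ εs : ℝ, 0 < εs ∧ ∀ ε₁, ε₁ < εs →
      C3 * ε₁ * Real.exp (5 * κ + 1) * K₀ 64 8 * 9 * 64 ≤ 1 ∧
        Real.exp 1 * 9 * 64 * K₀ 64 8 ^ 2 * C3 * cH * ε₁ < (θ' - ω) * (1 - ρ₀) := by
  have hK : 0 ≤ K₀ 64 8 := (Literature.MathematicalPhysics.QuantumFieldTheory.Balaban1983to89.B12TreeDecay.K₀_pos 64 8).le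
  set a₁ : ℝ := C3 * Real.exp (5 * κ + 1) * K₀ 64 8 * 9 * 64 with ha₁_def
  set a₂ : ℝ := Real.exp 1 * 9 * 64 * K₀ 64 8 ^ 2 * C3 * cH with ha₂_def
  have ha₁ : 0 ≤ a₁ := by positivity
  have ha₂ : 0 ≤ a₂ := by positivity
  have hT : 0 < (θ' - ω) * (1 - ρ₀) := mul_pos (sub_pos.2 hωθ') (sub_pos.2 hρ₀)
  refine ⟨min (1 / (a₁ + 1)) ((θ' - ω) * (1 - ρ₀) / (a₂ + 1)),
    lt_min (div_pos one_pos (by linarith)) (div_pos hT (by linarith)), fun ε₁ hε₁ => ⟨?_, ?_⟩⟩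
  · have h1 : a₁ * ε₁ < 1 := mul_lt_of_lt_threshold ha₁ one_pos (hε₁.trans_le (min_le_left _ _))
    have h2 : C3 * ε₁ * Real.exp (5 * κ + 1) * K₀ 64 8 * 9 * 64 = a₁ * ε₁ := by rw [ha₁_def]; ring
    rw [h2]; exact h1.le
  · exact mul_lt_of_lt_threshold ha₂ hT (hε₁.trans_le (min_le_right _ _))

/-- **E1′ ON THE CARRIERS OF RECORD AT MAJORANT CONSTANT `C₃·ε₁`, BOTH W2 CLAUSES AS ε₁-CONDITIONS** — §2 with `A := C₃·ε₁`: the [KP86]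
clause supplied as `C₃ε₁·e^{5κ+1}·K₀(64,8)·576 ≤ 1`, L11 as `(e·576·K₀(64,8)²·C₃)·cH·ε₁ < (θ′−ω)(1−ρ₀)` (turned into the face's `l11` by
`SmallnessPrintedKind.smallness_of_eps`); L10 displayed; with `eps_threshold_record` both hold for every `ε₁ < ε⋆`. [folklore] -/
theorem ne5_of_leaves_fibre_activities_record_eps
    {act : (j : ℕ) → Op × Hist → TDom 4 (R.cubesPerDir j) → ℂ} {W : Set (ℕ → ℝ)} {C3 ε₁ Rd κ : ℝ}
    (hrep : ∀ (X : R.carriers.Dom) (z : Op × Hist),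
      M.Out X.1 z.1 z.2 X =
        locE (TTouch (d := 4) (N := R.cubesPerDir X.1)) (fun Z : (tsys 4 (R.cubesPerDir X.1)).Dom => Z.1) (act X.1 z) X.2.1)
    (hC3 : 0 ≤ C3) (hε₁ : 0 ≤ ε₁) (hκ : 0 ≤ κ) (hrate : κ + 2 * (64 * Real.log 162) + 2 ≤ Rd)
    (hKP : C3 * ε₁ * Real.exp (5 * κ + 1) * K₀ 64 8 * 9 * 64 ≤ 1)
    (hH : ∀ j, ∀ g ∈ W, ∀ (U : R.carriers.BgB) (p : Op × Hist), p ∈ M.Base j g U →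
      ∃ V : Set (Op × Hist), IsOpen V ∧ M.box j p ⊆ V ∧
        (∀ Z : TDom 4 (R.cubesPerDir j), DifferentiableOn ℂ (fun z : Op × Hist => act j z Z) V) ∧
        (∀ z ∈ V, ∀ Z : TDom 4 (R.cubesPerDir j), ‖act j z Z‖ ≤ C3 * ε₁ * Real.exp (-(Rd * torusTreeLen Z.1))))
    {EA : Functional R.carriers R.carriers.BgA} {EB : Functional R.carriers R.carriers.BgB}
    {EA₀ E₀ E₁ δ δ' θ θ' cH ω ρ₀ B : ℝ} {k₀ : ℕ}
    (l01 : L01 M EA W) (l02 : L02 M EB W) (l03 : L03 M EB W) (l05 : L05 EA W EA₀ κ) (l06 : L06 EB W E₀ κ)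
    (l07 : L07 M W δ θ) (l08 : L08 M W κ E₀ δ' θ) (l09aff : L09aff M W) (l09blind : L09blind M W) (l09hom : L09hom M W)
    (l09unit : L09unit M W κ E₁ cH ω) (hE₁ : 0 < E₁) (hδ : 0 ≤ δ + δ') (hθ : 0 ≤ θ) (hθθ' : θ ≤ θ') (hθ'1 : θ' ≤ 1)
    (hcH : 0 ≤ cH) (hω : 0 < ω) (hρ₀ : ρ₀ < 1) (l10near : (δ + δ') * θ ^ k₀ + cH * (EA₀ + E₀) / (1 - ω) ≤ ρ₀) (hB : 0 ≤ B)
    (l10first : ∀ k < k₀, EA₀ + E₀ ≤ B * θ ^ k)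
    (hS : Real.exp 1 * 9 * 64 * K₀ 64 8 ^ 2 * C3 * cH * ε₁ < (θ' - ω) * (1 - ρ₀)) :
    NE5 EA EB W κ θ'
      ((Real.exp 1 * 9 * 64 * K₀ 64 8 ^ 2 * (C3 * ε₁) / (1 - ρ₀) * (δ + δ') + B) * (θ' - ω) /
        (θ' - (ω + Real.exp 1 * 9 * 64 * K₀ 64 8 ^ 2 * (C3 * ε₁) / (1 - ρ₀) * cH))) := by
  have l11 : ω + Real.exp 1 * 9 * 64 * K₀ 64 8 ^ 2 * (C3 * ε₁) / (1 - ρ₀) * cH < θ' := by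
    have h := smallness_of_eps (G := Real.exp 1 * 9 * 64 * K₀ 64 8 ^ 2 * C3) (cI := cH) (ε₁ := ε₁) hρ₀ hS
    have heq : Real.exp 1 * 9 * 64 * K₀ 64 8 ^ 2 * C3 / (1 - ρ₀) * (cH * ε₁) =
        Real.exp 1 * 9 * 64 * K₀ 64 8 ^ 2 * (C3 * ε₁) / (1 - ρ₀) * cH := by ring
    rwa [heq] at h
  exact ne5_of_leaves_fibre_activities_record R M hrep (mul_nonneg hC3 hε₁) hκ hrate hKP hH l01 l02 l03 l05 l06 l07 l08 l09aff
    l09blind l09hom l09unit hE₁ hδ hθ hθθ' hθ'1 hcH hω hρ₀ l10near hB l10first l11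

end RecordEps

end Summit.QuantumFields.BalabanUV.T4Continuum.Spine.NE5
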